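import Mathlib
import Summits.Ventures.PercRepro2.Defs
import Summits.Ventures.PercRepro2.Graph
import Summits.Ventures.PercRepro2.Induced
import Summits.Ventures.PercRepro2.VdBKahn
import Summits.Ventures.PercRepro2.ReimerVdBK
import Summits.Ventures.PercRepro2.ReimerVdBKRegions
import Summits.Ventures.PercRepro2.ReimerVdBKZClosed
import Summits.Ventures.PercRepro2.ReimerVdBKZReduction

/-!
# The one-edge split of (R-1.2) at a doubly-avoided vertex, and the recursion step
(blind cell PercRepro2, mine-c g46; `conjectures/MINE-C.md` §55 — the Z-reduction one edge at a time)

Let `z ∈ X ∩ Y` (a vertex avoided by both worlds), `z ≠ s`, and let `e` be an edge `{z, y}`.  Colour `e`.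
If `e` is open in world 1 then «`z ∉ K₁`» forces «`y ∉ K₁`» and the edge carries nothing; if `e` is open in
world 2 the same happens in world 2.  Writing `G'` for the graph in which `e` has become a loop (`loopAt`:
the edge is deleted from both worlds, the edge type is kept, so `G'` double-counts every event of `G − e`),

  **`2 · Φ_G(A, X; B, Y) = Φ_{G'}(A, X ∪ {y}; B, Y) + Φ_{G'}(A, X; B, Y ∪ {y})`**   (`reimerCount_split`)

for EVERY instance with `z ∈ X ∩ Y` — the right side of (R-1.2) is such an instance too.  Comparing the two
expansions, the terms match whenever `y` is MARKED (`y ∈ A ∪ B ∪ X ∪ Y`), is the root, or `e` is a loop: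
a neighbour in `X` or `Y` turns the two sub-instances into exactly the two terms of the right side; a
neighbour in `A` (resp. `B`) kills the sub-instance that pins it away from world 1 (resp. 2) and the other
sub-instance is bounded by one right-hand term.  THEOREM `rvdBK_split`: (R-1.2) on `G` follows from
(R-1.2) on `G'` for the (at most two) surviving sub-instances.  An UNMARKED neighbour is exactly where the
terms do not match (`MINE-C.md` §52.2 (c), §54.11) — the recursion stops there.
`ReimerVdBKZRecursion` iterates the step to a theorem.
-/

namespace Summit.Ventures.PercRepro2
namespace ReimerVdBK
open Classical

variable {V : Type*} {E : Type*} [Fintype E] [DecidableEq E] [Fintype V] [DecidableEq V]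
variable (ends : E → Sym2 V)

/-! ## Turning an edge into a loop -/

/-- The graph in which the edge `e` has become a loop at `z`: `e` is deleted from both worlds while the edge
type is kept (a loop never contributes an adjacency). -/
def loopAt (e : E) (z : V) : E → Sym2 V := Function.update ends e s(z, z)

omit [Fintype E] [Fintype V] [DecidableEq V] in
/-- The looped edge. -/
lemma loopAt_apply_self (e : E) (z : V) : loopAt ends e z e = s(z, z) := by
  simp [loopAt]

omit [Fintype E] [Fintype V] [DecidableEq V] in
/-- Every other edge is unchanged. -/
lemma loopAt_apply_of_ne {e f : E} (hfe : f ≠ e) (z : V) : loopAt ends e z f = ends f := by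
  simp [loopAt, Function.update_of_ne hfe]

omit [Fintype E] [Fintype V] [DecidableEq V] in
/-- Closing one edge only decreases the configuration. -/
lemma update_false_le (ω : Config E) (e : E) : Function.update ω e false ≤ ω := by
  intro f
  by_cases hfe : f = e
  · subst hfe; simp
  · simp [Function.update_of_ne hfe]

omit [Fintype E] [Fintype V] [DecidableEq V] in
/-- The open subgraph of the looped graph is the open subgraph of `ω` with `e` closed. -/
lemma openGraph_loopAt (e : E) (z : V) (ω : Config E) :
    openGraph (loopAt ends e z) ω = openGraph ends (Function.update ω e false) := by
  ext u v
  simp only [openGraph_adj, OpenAdj]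
  constructor
  · rintro ⟨huv, f, hf, hends⟩
    have hfe : f ≠ e := by
      rintro rfl
      rw [loopAt_apply_self, Sym2.eq_iff] at hends
      rcases hends with ⟨h1, h2⟩ | ⟨h1, h2⟩
      · exact huv (h1.symm.trans h2)
      · exact huv (h2.symm.trans h1)
    rw [loopAt_apply_of_ne ends hfe] at hends
    exact ⟨huv, f, by rw [Function.update_of_ne hfe]; exact hf, hends⟩
  · rintro ⟨huv, f, hf, hends⟩
    have hfe : f ≠ e := by
      rintro rfl
      rw [Function.update_self] at hf
      exact Bool.false_ne_true hf
    rw [Function.update_of_ne hfe] at hf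
    exact ⟨huv, f, hf, by rw [loopAt_apply_of_ne ends hfe]; exact hends⟩

omit [Fintype E] [Fintype V] [DecidableEq V] in
/-- Connection in the looped graph is connection in `ω` with `e` closed. -/
lemma conn_loopAt_iff (e : E) (z : V) (ω : Config E) (u v : V) :
    Conn (loopAt ends e z) ω u v ↔ Conn ends (Function.update ω e false) u v := by
  unfold Conn
  rw [openGraph_loopAt]

variable (s : V)

omit [Fintype E] [Fintype V] [DecidableEq V] in
/-- **Closing an edge at an unreached vertex changes nothing**: if `s` does not reach `z` and `z ∈ e`, then
`s ↔ v` in `ω` iff `s ↔ v` in `ω` with `e` closed. -/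
theorem conn_update_false_iff {z : V} {e : E} (hze : z ∈ ends e) {ω : Config E}
    (hz : ¬ Conn ends ω s z) (v : V) :
    Conn ends ω s v ↔ Conn ends (Function.update ω e false) s v := by
  constructor
  · intro h
    let S : Set V := {x | Conn ends (Function.update ω e false) s x}
    have hS : ∀ x ∈ S, ∀ y, (openGraph ends ω).Adj x y → y ∈ S := by
      intro x hx y hxy
      obtain ⟨_, f, hf, hends⟩ := openGraph_adj.1 hxy
      have hxω : Conn ends ω s x := conn_mono (update_false_le ω e) hx
      have hyω : Conn ends ω s y := conn_trans hxω (conn_of_openAdj ⟨f, hf, hends⟩)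
      have hfe : f ≠ e := by
        rintro rfl
        rw [hends, Sym2.mem_iff] at hze
        rcases hze with h' | h'
        · exact hz (by rw [h']; exact hxω)
        · exact hz (by rw [h']; exact hyω)
      have hf' : Function.update ω e false f = true := by
        rw [Function.update_of_ne hfe]; exact hf
      exact conn_trans hx (conn_of_openAdj ⟨f, hf', hends⟩)
    exact mem_of_conn_of_closed hS (conn_refl ends _ s) h
  · exact conn_mono (update_false_le ω e)

omit [Fintype E] [Fintype V] [DecidableEq V] in
/-- **The root does not reach `z` through an open edge `{z, y}` iff, with that edge closed, it reaches
neither `z` nor `y`.** -/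
theorem not_conn_iff_of_open {z y : V} {e : E} (hends : ends e = s(z, y)) {ω : Config E}
    (he : ω e = true) (hsz : s ≠ z) :
    ¬ Conn ends ω s z ↔
      ¬ Conn ends (Function.update ω e false) s z ∧ ¬ Conn ends (Function.update ω e false) s y := by
  constructor
  · intro hz
    refine ⟨fun h => hz (conn_mono (update_false_le ω e) h), fun h => hz ?_⟩
    have hy : Conn ends ω s y := conn_mono (update_false_le ω e) h
    exact conn_trans hy (conn_of_openAdj ⟨e, he, by rw [hends, Sym2.eq_swap]⟩)
  · rintro ⟨hz0, hy0⟩ h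
    let S : Set V := {x | x ≠ z ∧ Conn ends (Function.update ω e false) s x}
    have hS : ∀ x ∈ S, ∀ y', (openGraph ends ω).Adj x y' → y' ∈ S := by
      intro x hx y' hxy
      obtain ⟨hxz, hxc⟩ := hx
      obtain ⟨_, f, hf, hends'⟩ := openGraph_adj.1 hxy
      by_cases hfe : f = e
      · rw [hfe, hends, Sym2.eq_iff] at hends'
        rcases hends' with ⟨h1, _⟩ | ⟨_, h2⟩
        · exact absurd h1.symm hxz
        · exact absurd (by rw [h2]; exact hxc) hy0
      · have hf' : Function.update ω e false f = true := by
          rw [Function.update_of_ne hfe]; exact hf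
        have hy'c : Conn ends (Function.update ω e false) s y' :=
          conn_trans hxc (conn_of_openAdj ⟨f, hf', hends'⟩)
        exact ⟨fun hyz => hz0 (by rw [← hyz]; exact hy'c), hy'c⟩
    have := mem_of_conn_of_closed hS ⟨hsz, conn_refl ends _ s⟩ h
    exact this.1 rfl

/-! ## The two-world event, split by the colour of one edge at `z` -/

omit [Fintype E] [Fintype V] in
/-- With `e = {z, y}` open in world 1 and `z ∈ X ∩ Y`: the two-world event of `(A, X; B, Y)` on `G` is the
two-world event of `(A, X ∪ {y}; B, Y)` on the looped graph. -/
theorem mem_twoWorld_split_true {z y : V} {e : E} (hends : ends e = s(z, y)) (hsz : s ≠ z)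
    {A X B Y : Finset V} (hzX : z ∈ X) {ω : Config E} (he : ω e = true) :
    ω ∈ twoWorld ends s A X B Y ↔ ω ∈ twoWorld (loopAt ends e z) s A (insert y X) B Y := by
  have hze : z ∈ ends e := by rw [hends]; exact Sym2.mem_mk_left z y
  have h : compl ω e = false := by simp [compl, he]
  have hupd : Function.update (compl ω) e false = compl ω := by
    conv_rhs => rw [← Function.update_eq_self e (compl ω)]
    rw [h]
  simp only [twoWorld, connAll, avoidAll, Set.mem_inter_iff, Set.mem_setOf_eq, mem_bar,
    Finset.mem_insert, forall_eq_or_imp, conn_loopAt_iff, hupd]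
  constructor
  · rintro ⟨⟨ha, hx⟩, hb, hy⟩
    have hz : ¬ Conn ends ω s z := hx z hzX
    obtain ⟨_, hy0⟩ := (not_conn_iff_of_open ends s hends he hsz).1 hz
    exact ⟨⟨fun a ha' => (conn_update_false_iff ends s hze hz a).1 (ha a ha'), hy0,
      fun x hx' h => hx x hx' ((conn_update_false_iff ends s hze hz x).2 h)⟩, hb, hy⟩
  · rintro ⟨⟨ha, hy0, hx⟩, hb, hy⟩
    have hz : ¬ Conn ends ω s z := (not_conn_iff_of_open ends s hends he hsz).2 ⟨hx z hzX, hy0⟩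
    exact ⟨⟨fun a ha' => (conn_update_false_iff ends s hze hz a).2 (ha a ha'),
      fun x hx' h => hx x hx' ((conn_update_false_iff ends s hze hz x).1 h)⟩, hb, hy⟩

omit [Fintype E] [Fintype V] in
/-- With `e = {z, y}` open in world 2 and `z ∈ X ∩ Y`: the two-world event of `(A, X; B, Y)` on `G` is the
two-world event of `(A, X; B, Y ∪ {y})` on the looped graph. -/
theorem mem_twoWorld_split_false {z y : V} {e : E} (hends : ends e = s(z, y)) (hsz : s ≠ z)
    {A X B Y : Finset V} (hzY : z ∈ Y) {ω : Config E} (he : ω e = false) :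
    ω ∈ twoWorld ends s A X B Y ↔ ω ∈ twoWorld (loopAt ends e z) s A X B (insert y Y) := by
  have hze : z ∈ ends e := by rw [hends]; exact Sym2.mem_mk_left z y
  have he' : compl ω e = true := by simp [compl, he]
  have hupd : Function.update ω e false = ω := by
    conv_rhs => rw [← Function.update_eq_self e ω]
    rw [he]
  simp only [twoWorld, connAll, avoidAll, Set.mem_inter_iff, Set.mem_setOf_eq, mem_bar,
    Finset.mem_insert, forall_eq_or_imp, conn_loopAt_iff, hupd]
  constructor
  · rintro ⟨⟨ha, hx⟩, hb, hy⟩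
    have hz : ¬ Conn ends (compl ω) s z := hy z hzY
    obtain ⟨_, hy0⟩ := (not_conn_iff_of_open ends s hends he' hsz).1 hz
    exact ⟨⟨ha, hx⟩, fun b hb' => (conn_update_false_iff ends s hze hz b).1 (hb b hb'), hy0,
      fun y' hy' h => hy y' hy' ((conn_update_false_iff ends s hze hz y').2 h)⟩
  · rintro ⟨⟨ha, hx⟩, hb, hy0, hy⟩
    have hz : ¬ Conn ends (compl ω) s z :=
      (not_conn_iff_of_open ends s hends he' hsz).2 ⟨hy z hzY, hy0⟩
    exact ⟨⟨ha, hx⟩, fun b hb' => (conn_update_false_iff ends s hze hz b).2 (hb b hb'),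
      fun y' hy' h => hy y' hy' ((conn_update_false_iff ends s hze hz y').1 h)⟩

/-! ## Counting -/

omit [Fintype V] [DecidableEq V] in
/-- An event blind to the colour of `e` has as many configurations with `e` of either colour:
`count W = 2 · #{ω ∈ W : ω e = b}`. -/
lemma count_eq_two_mul_filter {W : Set (Config E)} (e : E)
    (hW : ∀ ω b, Function.update ω e b ∈ W ↔ ω ∈ W) (b : Bool) :
    (count W : ℚ) = 2 * ∑ ω : Config E, if ω ∈ W ∧ ω e = b then 1 else 0 := by
  have h := sum_flip e (fun ω => if ω ∈ W then (1 : ℚ) else 0)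
    (fun _ b' => if b' = b then (1 : ℚ) else 0)
    (fun ω b' => by simp only [hW]) (fun _ _ _ => rfl)
  have hsum : ∀ ω : Config E, (if ω ∈ W then (1 : ℚ) else 0) *
      ((if true = b then (1 : ℚ) else 0) + (if false = b then 1 else 0)) =
      if ω ∈ W then 1 else 0 := by
    intro ω; cases b <;> simp
  have hsum' : ∀ ω : Config E, (if ω ∈ W then (1 : ℚ) else 0) * (if ω e = b then (1 : ℚ) else 0) =
      if ω ∈ W ∧ ω e = b then 1 else 0 := by
    intro ω
    by_cases h1 : ω ∈ W <;> by_cases h2 : ω e = b <;> simp [h1, h2]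
  simp only [hsum, hsum'] at h
  unfold count
  push_cast
  exact h.symm

omit [Fintype V] in
/-- **The one-edge split** at a doubly-avoided vertex: for `z ∈ X ∩ Y`, `z ≠ s` and an edge `e = {z, y}`,
`2 · Φ_G(A, X; B, Y) = Φ_{G'}(A, X ∪ {y}; B, Y) + Φ_{G'}(A, X; B, Y ∪ {y})`, where `G'` is `G` with `e`
turned into a loop. -/
theorem reimerCount_split {z y : V} {e : E} (hends : ends e = s(z, y)) (hsz : s ≠ z)
    {A X B Y : Finset V} (hzX : z ∈ X) (hzY : z ∈ Y) :
    2 * reimerCount ends s A X B Y =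
      reimerCount (loopAt ends e z) s A (insert y X) B Y +
        reimerCount (loopAt ends e z) s A X B (insert y Y) := by
  have hblind : ∀ (A' X' B' Y' : Finset V) (ω : Config E) (b : Bool),
      Function.update ω e b ∈ twoWorld (loopAt ends e z) s A' X' B' Y' ↔
        ω ∈ twoWorld (loopAt ends e z) s A' X' B' Y' := by
    intro A' X' B' Y' ω b
    have h1 : ∀ v, Conn (loopAt ends e z) (Function.update ω e b) s v ↔
        Conn (loopAt ends e z) ω s v := by
      intro v; rw [conn_loopAt_iff, conn_loopAt_iff, Function.update_idem]
    have h2 : ∀ v, Conn (loopAt ends e z) (compl (Function.update ω e b)) s v ↔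
        Conn (loopAt ends e z) (compl ω) s v := by
      intro v; rw [compl_update_eq, conn_loopAt_iff, conn_loopAt_iff, Function.update_idem]
    simp only [twoWorld, connAll, avoidAll, Set.mem_inter_iff, Set.mem_setOf_eq, mem_bar, h1, h2]
  have key : ∀ ω : Config E, (if ω ∈ twoWorld ends s A X B Y then (1 : ℚ) else 0) =
      (if ω ∈ twoWorld (loopAt ends e z) s A (insert y X) B Y ∧ ω e = true then 1 else 0) +
      (if ω ∈ twoWorld (loopAt ends e z) s A X B (insert y Y) ∧ ω e = false then 1 else 0) := by
    intro ω
    cases he : ω e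
    · rw [mem_twoWorld_split_false ends s hends hsz hzY he]; simp
    · rw [mem_twoWorld_split_true ends s hends hsz hzX he]; simp
  rw [← Nat.cast_inj (R := ℚ)]
  push_cast
  unfold reimerCount
  rw [count_eq_two_mul_filter e (hblind _ _ _ _) true, count_eq_two_mul_filter e (hblind _ _ _ _) false]
  unfold count
  push_cast
  rw [Finset.sum_congr rfl (fun ω _ => key ω), Finset.sum_add_distrib]
  ring

/-! ## Degenerate instances: the left side vanishes -/

omit [Fintype V] [DecidableEq V] in
/-- A vertex in `A ∩ X` empties the left event. -/
lemma reimerCount_eq_zero_of_not_disjoint_left {A X : Finset V} (h : ¬ Disjoint A X) (B Y : Finset V) :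
    reimerCount ends s A X B Y = 0 := by
  obtain ⟨a, haA, haX⟩ := Finset.not_disjoint_iff.1 h
  unfold reimerCount count
  refine Finset.sum_eq_zero fun ω _ => ?_
  rw [if_neg]
  rintro ⟨⟨ha, hx⟩, -⟩
  exact hx a haX (ha a haA)

omit [Fintype V] [DecidableEq V] in
/-- A vertex in `B ∩ Y` empties the left event. -/
lemma reimerCount_eq_zero_of_not_disjoint_right (A X : Finset V) {B Y : Finset V}
    (h : ¬ Disjoint B Y) : reimerCount ends s A X B Y = 0 := by
  obtain ⟨b, hbB, hbY⟩ := Finset.not_disjoint_iff.1 h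
  unfold reimerCount count
  refine Finset.sum_eq_zero fun ω _ => ?_
  rw [if_neg]
  rintro ⟨-, hb, hy⟩
  exact hy b hbY (hb b hbB)

omit [Fintype V] [DecidableEq V] in
/-- The root cannot be avoided by world 1. -/
lemma reimerCount_eq_zero_of_root_mem_X (A : Finset V) {X : Finset V} (h : s ∈ X) (B Y : Finset V) :
    reimerCount ends s A X B Y = 0 := by
  unfold reimerCount count
  refine Finset.sum_eq_zero fun ω _ => ?_
  rw [if_neg]
  rintro ⟨⟨-, hx⟩, -⟩
  exact hx s h (conn_refl ends ω s)

omit [Fintype V] [DecidableEq V] in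
/-- The root cannot be avoided by world 2. -/
lemma reimerCount_eq_zero_of_root_mem_Y (A X B : Finset V) {Y : Finset V} (h : s ∈ Y) :
    reimerCount ends s A X B Y = 0 := by
  unfold reimerCount count
  refine Finset.sum_eq_zero fun ω _ => ?_
  rw [if_neg]
  rintro ⟨-, -, hy⟩
  exact hy s h (conn_refl ends (compl ω) s)

/-! ## The recursion step -/

omit [Fintype V] in
/-- **The recursion step of (R-1.2) along an edge at a doubly-avoided vertex.**  Let `z ∈ X ∩ Y`, `z ≠ s`,
`e = {z, y}`, with `A ∩ X = B ∩ Y = ∅`, and let `y` be the root, or `z` itself (a loop), or MARKED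
(`y ∈ A ∪ B ∪ X ∪ Y`).  If (R-1.2) holds on the looped graph `G'` for `(A, X ∪ {y}; B, Y)` (needed only when
`y ∉ A`, `y ≠ s`) and for `(A, X; B, Y ∪ {y})` (needed only when `y ∉ B`, `y ≠ s`), then (R-1.2) holds on
`G` for `(A, X; B, Y)`. -/
theorem rvdBK_split {z y : V} {e : E} (hends : ends e = s(z, y)) (hsz : s ≠ z) {A X B Y : Finset V}
    (hzX : z ∈ X) (hzY : z ∈ Y) (hAX : Disjoint A X) (hBY : Disjoint B Y)
    (hy : y = s ∨ y = z ∨ y ∈ A ∨ y ∈ B ∨ y ∈ X ∨ y ∈ Y)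
    (h1 : y ≠ s → y ∉ A → RvdBK (loopAt ends e z) s A (insert y X) B Y)
    (h2 : y ≠ s → y ∉ B → RvdBK (loopAt ends e z) s A X B (insert y Y)) :
    RvdBK ends s A X B Y := by
  have hL := reimerCount_split ends s hends hsz (A := A) (B := B) hzX hzY
  have hR := reimerCount_split ends s hends hsz (A := A ∪ B) (X := X ∩ Y) (B := ∅) (Y := X ∪ Y)
    (Finset.mem_inter.2 ⟨hzX, hzY⟩) (Finset.mem_union_left _ hzX)
  unfold RvdBK at h1 h2 ⊢
  by_cases hys : y = s
  · -- the root: both sub-instances are empty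
    subst hys
    have e1 := reimerCount_eq_zero_of_root_mem_X (loopAt ends e z) y A (Finset.mem_insert_self y X) B Y
    have e2 := reimerCount_eq_zero_of_root_mem_Y (loopAt ends e z) y A X B (Finset.mem_insert_self y Y)
    omega
  by_cases hyz : y = z
  · -- a loop: both sub-instances are the instance itself
    subst hyz
    have hX : insert y X = X := Finset.insert_eq_of_mem hzX
    have hY : insert y Y = Y := Finset.insert_eq_of_mem hzY
    have hXY : insert y (X ∩ Y) = X ∩ Y := Finset.insert_eq_of_mem (Finset.mem_inter.2 ⟨hzX, hzY⟩)
    have hXuY : insert y (X ∪ Y) = X ∪ Y := Finset.insert_eq_of_mem (Finset.mem_union_left _ hzX)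
    have hyA : y ∉ A := Finset.disjoint_right.1 hAX hzX
    have h := h1 hys hyA
    rw [hX] at h hL
    rw [hY] at hL
    rw [hXY, hXuY] at hR
    omega
  by_cases hyA : y ∈ A
  · -- `y ∈ A`: the first sub-instance is empty, the second is bounded by the second right-hand term
    have hyX : y ∉ X := Finset.disjoint_left.1 hAX hyA
    have e1 : reimerCount (loopAt ends e z) s A (insert y X) B Y = 0 :=
      reimerCount_eq_zero_of_not_disjoint_left (loopAt ends e z) s
        (Finset.not_disjoint_iff.2 ⟨y, hyA, Finset.mem_insert_self y X⟩) B Y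
    by_cases hyB : y ∈ B
    · have e2 : reimerCount (loopAt ends e z) s A X B (insert y Y) = 0 :=
        reimerCount_eq_zero_of_not_disjoint_right (loopAt ends e z) s A X
          (Finset.not_disjoint_iff.2 ⟨y, hyB, Finset.mem_insert_self y Y⟩)
      omega
    · have h := h2 hys hyB
      rw [Finset.inter_insert_of_notMem hyX, Finset.union_insert] at h
      omega
  by_cases hyB : y ∈ B
  · -- `y ∈ B ∖ A`: symmetric
    have hyY : y ∉ Y := Finset.disjoint_left.1 hBY hyB
    have e2 : reimerCount (loopAt ends e z) s A X B (insert y Y) = 0 :=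
      reimerCount_eq_zero_of_not_disjoint_right (loopAt ends e z) s A X
        (Finset.not_disjoint_iff.2 ⟨y, hyB, Finset.mem_insert_self y Y⟩)
    have h := h1 hys hyA
    rw [Finset.insert_inter_of_notMem hyY, Finset.insert_union] at h
    omega
  by_cases hyX : y ∈ X
  · -- `y ∈ X`, unpinned: the two sub-instances are the two right-hand terms
    have hX : insert y X = X := Finset.insert_eq_of_mem hyX
    have hXuY : insert y (X ∪ Y) = X ∪ Y := Finset.insert_eq_of_mem (Finset.mem_union_left _ hyX)
    have ha := h1 hys hyA
    have hb := h2 hys hyB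
    rw [hX] at ha hL
    rw [hXuY] at hR
    rw [Finset.inter_insert_of_mem hyX, Finset.union_insert, hXuY] at hb
    omega
  · -- `y ∈ Y`, unpinned: symmetric
    have hyY : y ∈ Y := by
      rcases hy with h | h | h | h | h | h
      · exact absurd h hys
      · exact absurd h hyz
      · exact absurd h hyA
      · exact absurd h hyB
      · exact absurd h hyX
      · exact h
    have hY : insert y Y = Y := Finset.insert_eq_of_mem hyY
    have hXuY : insert y (X ∪ Y) = X ∪ Y := Finset.insert_eq_of_mem (Finset.mem_union_right _ hyY)
    have ha := h1 hys hyA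
    have hb := h2 hys hyB
    rw [hY] at hb hL
    rw [hXuY] at hR
    rw [Finset.insert_inter_of_mem hyY, Finset.insert_union, hXuY] at ha
    omega

end ReimerVdBK
end Summit.Ventures.PercRepro2
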